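import Summits.AtomisticToContinuum.FouriersLaw.Theses.ParityLiouvilleSeed

/-!
# `Lines/birth.lean` — birth skeleton for the crux `ParityLiouvilleSeed.NessTightness`
(crux item stmt-AtomisticToContinuum-13978, rank 4; routes `route-AtomisticToContinuum-ParityLiouvilleSeed`,
`route-AtomisticToContinuum-LogConcaveRigidity`; skeleton-register, planner one-shot)

Crux (FIXED, concluded BY NAME): `NessTightness` — for `P = pinnedChain ω₂ lam β γ` (all four `> 0`) and bath
temperatures `T_L, T_R > 0`, for every order `m` there is `C` with `∫ (|q_i|^m + |p_i|^m) dμ ≤ C` (and the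
integrand integrable) for EVERY length `N`, EVERY weak steady state `μ` of the `N`-chain and EVERY site `i`.

THE SEAM. A uniform moment bound has two logically and physically different layers, and the skeleton cuts
exactly between them:

* **S1 `stub_uniformSecondMoments` (THERMODYNAMIC LEVEL — bounded temperature / displacement profile).**
  `sup_{N, μ, i} ∫ (|q_i|² + |p_i|²) dμ < ∞`: the kinetic temperatures `⟨p_i²⟩` and mean-square displacements
  are bounded uniformly in the length, the state and the site. This is the level reached by ENTROPY methods:
  it follows from the sister crux `NessRegularity` (box relative entropy `≤ C(n+1)` w.r.t. a shift-invariant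
  Gibbs state, box size `n = 0`) by the entropy inequality `∫F dμ ≤ H(μ_{i} ‖ g) + log ∫ e^F dg` with
  `F = a(p²/2 + ω₂ q²/2)`, `a < 1/T` (the single-site Gibbs marginal `g` has Gaussian-in-`p`,
  quartic-in-`q` tails since `V ≥ 0`); and it is where numerics on temperature profiles speak. It is NOT the
  crux: entropy bounds of order `C` allow `q`-tails `μ(|q_i| > R) ≳ C·T/(lam R⁴)`, i.e. no moment of order `> 4`.
* **S2 `stub_momentStep` (TAIL LEVEL — one-order moment bootstrap, uniform in `N`).** For `m ≥ 2`: an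
  `N`-, state- and site-uniform bound of order `m` at ALL sites forces one of order `m + 1`. This is the
  DYNAMICAL content of the crux beyond `NessRegularity`: local large deviations of a steady state with bounded
  local temperature should be Gibbs-like, and a high-energy excursion ("breather") at an interior site must be
  fed through, and leak through, its neighbours — under CEHR condition C5 (interaction degree `4 ≥` pinning
  degree `4`, the BORDERLINE case for `pinnedChain`) high-energy sites do not decouple, so lifetimes are at most
  polynomial in the energy while creation rates are exponentially small. Candidate engines: stationarity tested
  against site-local Lyapunov polynomials `e_i^k χ` (`𝓛 e_i = j_{i-1} - j_i` in the bulk, no bath term), the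
  CEHR high-energy dissipation core (`pinnedChain_sq_momentum_integral_lower_bound`,
  `LangevinChainDissipation`) localised to a window, reverse-Hölder for hypoelliptic invariant densities.
  Why it might fail: intermittent breather-like excitations far from equilibrium could give heavy (power-law)
  local-energy tails at bounded mean energy (Hairer–Mattingly 2009 slow dissipation when pinning dominates;
  here degree `4 = 4` is borderline), making the `N`-uniform constant of the step blow up at some order.

GLUE `NessTightness_of : NessTightness` (real proof, its own body sorry-free; house style of the registered lines of
this sub-problem: hypothesis-free, the two stubs used BY NAME, so `sorryAx` enters only through them): induction on
the order from the base `m = 2` (S1) with the step S2 (`Nat.le_induction`), and the orders `m = 0, 1` by domination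
`|t|^m ≤ 1 + |t|²` on a probability measure (`IsSteadyState` carries `IsProbabilityMeasure`), constant `2 + C₂`.
`lean check --json`: rc 0, sorries 2 = the two `stub_*` (zero elsewhere).

Exactness of the cut: `NessTightness → S1` (order 2) and `NessTightness → S2` (the conclusion of S2 is an
instance of the crux), and `S1 ∧ S2 → NessTightness` (below) — no stub is stronger than needed; neither stub
alone is the crux (S1: order 2 only; S2: conditional) nor the summit `FouriersLaw` (BC3 probes, NOTES.md).
Disproof.lean: none exists for this crux yet (`ledger crux ls`: no workfiles) — nothing to honour.
-/

noncomputable section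

namespace Summit.AtomisticToContinuum.FouriersLaw.Cruxes.NessTightness.Birth

open MeasureTheory Filter Topology Set
open Literature.MathematicalPhysics.KineticTheory.HeatConduction
open Summit.AtomisticToContinuum.FouriersLaw.Theses.ParityLiouvilleSeed (NessTightness)

set_option linter.unusedVariables false

/-! ## S1 — thermodynamic level: N- and site-uniform second moments -/

/-- **S1 `stub_uniformSecondMoments`** (size L; the thermodynamic level). For `pinnedChain ω₂ lam β γ`
(all `> 0`) and `T_L, T_R > 0` there is `B` with `∫ (|q_i|² + |p_i|²) dμ ≤ B` (integrand integrable) for every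
`N`, every weak steady state `μ` of the `N`-chain and every site `i`: the kinetic-temperature and
mean-square-displacement profiles are bounded uniformly in the length. Supplier inside the route: the sister crux
`NessRegularity` + the entropy inequality at box size 1 (provable glue); independent suppliers: any `N`-uniform
energy-density bound. Why it might fail: interior hot spots — a temperature profile growing with `N`
(Bernardin 2014 §1.2: known bounds are polynomial in `N`). -/
theorem stub_uniformSecondMoments :
    ∀ ω₂ lam β γ : ℝ, 0 < ω₂ → 0 < lam → 0 < β → 0 < γ → ∀ T_L T_R : ℝ, 0 < T_L → 0 < T_R →
      ∃ B : ℝ, ∀ (N : ℕ) (μ : Measure (PhaseSpace N)),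
        (pinnedChain ω₂ lam β γ).IsSteadyState N T_L T_R μ →
          ∀ i : Fin N, Integrable (fun x => |x.1 i| ^ 2 + |x.2 i| ^ 2) μ ∧
            ∫ x, (|x.1 i| ^ 2 + |x.2 i| ^ 2) ∂μ ≤ B := by
  sorry

/-! ## S2 — tail level: the N-uniform one-order moment bootstrap -/

/-- **S2 `stub_momentStep`** (size L–XL; the dynamical content, HARDEST). For `pinnedChain ω₂ lam β γ`
(all `> 0`), `T_L, T_R > 0`, every order `m ≥ 2` and every `B` there is `C` such that for every `N` and every
weak steady state `μ` of the `N`-chain: if `∫ (|q_j|^m + |p_j|^m) dμ ≤ B` at ALL sites `j`, then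
`∫ (|q_i|^(m+1) + |p_i|^(m+1)) dμ ≤ C` at every site `i` (integrands integrable). Mechanism: Gibbs-like local
large deviations at bounded local temperature + no high-energy decoupling under CEHR C5 (site-local Lyapunov
polynomials tested against stationarity, `𝓛 e_i = j_{i-1} - j_i` in the bulk; CEHR dissipation core localised).
Why it might fail: heavy local-energy tails from intermittent breathers at bounded mean energy (borderline
degrees `4 = 4`; Hairer–Mattingly 2009). -/
theorem stub_momentStep :
    ∀ ω₂ lam β γ : ℝ, 0 < ω₂ → 0 < lam → 0 < β → 0 < γ → ∀ T_L T_R : ℝ, 0 < T_L → 0 < T_R →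
      ∀ m : ℕ, 2 ≤ m → ∀ B : ℝ, ∃ C : ℝ,
        ∀ (N : ℕ) (μ : Measure (PhaseSpace N)),
          (pinnedChain ω₂ lam β γ).IsSteadyState N T_L T_R μ →
            (∀ j : Fin N, Integrable (fun x => |x.1 j| ^ m + |x.2 j| ^ m) μ ∧
                ∫ x, (|x.1 j| ^ m + |x.2 j| ^ m) ∂μ ≤ B) →
              ∀ i : Fin N, Integrable (fun x => |x.1 i| ^ (m + 1) + |x.2 i| ^ (m + 1)) μ ∧
                ∫ x, (|x.1 i| ^ (m + 1) + |x.2 i| ^ (m + 1)) ∂μ ≤ C := by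
  sorry

/-! ## Glue -/

/-- Domination of low powers: `|t|^m ≤ 1 + |t|²` for `m ≤ 2`. -/
theorem abs_pow_le_one_add_sq (t : ℝ) {m : ℕ} (hm : m ≤ 2) : |t| ^ m ≤ 1 + |t| ^ 2 := by
  rcases le_or_gt |t| 1 with h | h
  · calc |t| ^ m ≤ 1 := pow_le_one₀ (abs_nonneg t) h
      _ ≤ 1 + |t| ^ 2 := le_add_of_nonneg_right (by positivity)
  · calc |t| ^ m ≤ |t| ^ 2 := pow_le_pow_right₀ h.le hm
      _ ≤ 1 + |t| ^ 2 := le_add_of_nonneg_left zero_le_one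

/-- Orders `m ≤ 2` from order `2` on a probability measure (domination by `2 + (|q_i|² + |p_i|²)`). -/
theorem low_order_of_second {N : ℕ} (μ : Measure (PhaseSpace N)) [IsProbabilityMeasure μ] (i : Fin N)
    {C : ℝ} {m : ℕ} (hm : m ≤ 2)
    (hint : Integrable (fun x => |x.1 i| ^ 2 + |x.2 i| ^ 2) μ)
    (hle : ∫ x, (|x.1 i| ^ 2 + |x.2 i| ^ 2) ∂μ ≤ C) :
    Integrable (fun x => |x.1 i| ^ m + |x.2 i| ^ m) μ ∧
      ∫ x, (|x.1 i| ^ m + |x.2 i| ^ m) ∂μ ≤ 2 + C := by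
  have hg : Integrable (fun x : PhaseSpace N => (2 : ℝ) + (|x.1 i| ^ 2 + |x.2 i| ^ 2)) μ :=
    (integrable_const _).add hint
  have hcont : Continuous (fun x : PhaseSpace N => |x.1 i| ^ m + |x.2 i| ^ m) :=
    ((continuous_abs.comp ((continuous_apply i).comp continuous_fst)).pow m).add
      ((continuous_abs.comp ((continuous_apply i).comp continuous_snd)).pow m)
  have hpt : ∀ x : PhaseSpace N, |x.1 i| ^ m + |x.2 i| ^ m ≤ 2 + (|x.1 i| ^ 2 + |x.2 i| ^ 2) := by
    intro x
    have h1 := abs_pow_le_one_add_sq (x.1 i) hm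
    have h2 := abs_pow_le_one_add_sq (x.2 i) hm
    linarith
  have hbound : ∀ x : PhaseSpace N, ‖|x.1 i| ^ m + |x.2 i| ^ m‖ ≤ 2 + (|x.1 i| ^ 2 + |x.2 i| ^ 2) := by
    intro x
    rw [Real.norm_of_nonneg (by positivity)]
    exact hpt x
  have hint' : Integrable (fun x => |x.1 i| ^ m + |x.2 i| ^ m) μ :=
    hg.mono' hcont.aestronglyMeasurable (Eventually.of_forall hbound)
  refine ⟨hint', ?_⟩
  calc ∫ x, (|x.1 i| ^ m + |x.2 i| ^ m) ∂μ
      ≤ ∫ x, ((2 : ℝ) + (|x.1 i| ^ 2 + |x.2 i| ^ 2)) ∂μ := integral_mono hint' hg hpt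
    _ = 2 + ∫ x, (|x.1 i| ^ 2 + |x.2 i| ^ 2) ∂μ := by
        rw [integral_add (integrable_const _) hint, integral_const]
        simp
    _ ≤ 2 + C := by linarith

/-- **The kernel-checked composition**: S1 (uniform second moments) and S2 (the one-order bootstrap) give the
crux `NessTightness` BY NAME — induction on the order from `m = 2`, orders `0, 1` by domination. House style of the
registered lines of this sub-problem (`#h21_check_skeleton`: no `Prop` hypotheses other than registered obligations;
the stubs are used by name inside the proof, so this theorem's only `sorryAx` dependence is through
`stub_uniformSecondMoments` and `stub_momentStep`; its own body is sorry-free). -/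
theorem NessTightness_of : NessTightness := by
  intro ω₂ lam β γ hω hl hβ hγ T_L T_R hTL hTR m
  -- the order-`k` statement, uniform in `N`, the steady state and the site
  let P : ℕ → Prop := fun k => ∃ C : ℝ, ∀ (N : ℕ) (μ : Measure (PhaseSpace N)),
    (pinnedChain ω₂ lam β γ).IsSteadyState N T_L T_R μ →
      ∀ i : Fin N, Integrable (fun x => |x.1 i| ^ k + |x.2 i| ^ k) μ ∧
        ∫ x, (|x.1 i| ^ k + |x.2 i| ^ k) ∂μ ≤ C
  -- S1: the thermodynamic level is the base of the induction
  have base : P 2 := stub_uniformSecondMoments ω₂ lam β γ hω hl hβ hγ T_L T_R hTL hTR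
  -- S2: the N-uniform one-order bootstrap is the step
  have step : ∀ k : ℕ, 2 ≤ k → P k → P (k + 1) := by
    intro k hk hPk
    obtain ⟨B, hB⟩ := hPk
    obtain ⟨C, hC⟩ := stub_momentStep ω₂ lam β γ hω hl hβ hγ T_L T_R hTL hTR k hk B
    exact ⟨C, fun N μ hμ i => hC N μ hμ (fun j => hB N μ hμ j) i⟩
  have high : ∀ k : ℕ, 2 ≤ k → P k := by
    intro k hk
    induction k, hk using Nat.le_induction with
    | base => exact base
    | succ k hk ih => exact step k hk ih
  rcases le_or_gt 2 m with hm | hm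
  · exact high m hm
  · -- orders 0 and 1: dominate by the second moments on a probability measure
    obtain ⟨C₂, hC₂⟩ := base
    refine ⟨2 + C₂, fun N μ hμ i => ?_⟩
    haveI : IsProbabilityMeasure μ := hμ.1
    obtain ⟨hint, hle⟩ := hC₂ N μ hμ i
    exact low_order_of_second μ i hm.le hint hle

end Summit.AtomisticToContinuum.FouriersLaw.Cruxes.NessTightness.Birth

end
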